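import Mathlib
import HarnessLib
import Summits.Parity.BatemanHorn.Theorems.IsogenyRedeiSplitBlockJacobiCornerMbbSupport

/-!
# Support lemmas for `stub_mbb_of_boxInputs` (line `Sketch`, crux `SplitBlockJacobiCorner`,
# stmt-Parity-15002): from the K2′ trilinear bound to the block hypothesis of the Type II pieces

Def-free (the K2′ kernel `shortFactorTrilinearSum k α γ β M R T` is written out as its body
`Σ_{m ∈ (M,2M]} Σ_{r ∈ (R,2R]} Σ_{q ∈ (T,2T], q ≡ 1 (4), (mr,q) = 1} α(m)γ(r)β(q)(mr|q)S(k,mrq)`):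

* `trilinear_body_swap` — the body is symmetric under `(α, M) ↔ (γ, R)` (so K2′ may be applied with
  the short factor on either variable);
* `slice_pointwise` — for `S₂ = (T,t₂] ∩ {q ≡ 1}`, `t₂ ≤ 2T`:
  `c · Σ_{q ∈ S₂} g(q)(n|q)S(h,nq) = Σ_{q ∈ (T,2T], q≡1, (n,q)=1} c ([q ∈ S₂]g(q)) (n|q) S(h,nq)`
  (coprimality is free: `(n|q) = 0` otherwise);
* `typeII_H_of_K2` — hence `‖Σ α γ (L_c G(mr))‖ ≤ L_c L_g Y₀` for unit `α, γ` when the body is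
  `≤ Y₀` for all unit coefficients and `‖g‖ ≤ L_g` on `S₂`, `G(n) = Σ_{q ∈ S₂} g(q)(n|q)S(h,nq)`;
* `typeII_Phi` — the window majorant `τ(n)‖L_c G(n)‖ ≤ L_c L_g D³ · #S₂`.
-/

noncomputable section

open Finset

namespace Summit.Parity.BatemanHorn.Cruxes.SplitBlockJacobiCorner.Sketch.MbbOfBoxInputs

open Summit.Parity.BatemanHorn.Cruxes.SplitBlockJacobi.CofactorRootDiscrepancy

/-- **Symmetry of the K2′ body** under `(α, M) ↔ (γ, R)`. [folklore] -/
theorem trilinear_body_swap (k : ℤ) (α γ β : ℕ → ℂ) (M R T : ℕ) :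
    ∑ m ∈ Ioc M (2 * M), ∑ r ∈ Ioc R (2 * R),
        ∑ q ∈ (Ioc T (2 * T)).filter (fun q : ℕ => q % 4 = 1 ∧ Nat.Coprime (m * r) q),
          α m * γ r * β q * (jacobiSym ((m * r : ℕ) : ℤ) q : ℂ) * rootWeylSum k (m * r * q) =
      ∑ m ∈ Ioc R (2 * R), ∑ r ∈ Ioc M (2 * M),
        ∑ q ∈ (Ioc T (2 * T)).filter (fun q : ℕ => q % 4 = 1 ∧ Nat.Coprime (m * r) q),
          γ m * α r * β q * (jacobiSym ((m * r : ℕ) : ℤ) q : ℂ) * rootWeylSum k (m * r * q) := by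
  rw [Finset.sum_comm]
  refine Finset.sum_congr rfl fun r _ => Finset.sum_congr rfl fun m _ => ?_
  rw [mul_comm m r]
  refine Finset.sum_congr rfl fun q _ => ?_
  ring

/-- **Slice identity, pointwise in the product variable.** For `S₂ = (T,t₂] ∩ {q ≡ 1 (4)}`,
`t₂ ≤ 2T`, any `c : ℂ` and `n : ℕ`:
`c · Σ_{q ∈ S₂} g(q)(n|q)S(h,nq) = Σ_{q ∈ (T,2T], q≡1, (n,q)=1} c·([q ∈ S₂]g(q))·(n|q)·S(h,nq)`.
[folklore] -/
theorem slice_pointwise (h : ℤ) (g : ℕ → ℂ) (T t₂ : ℕ) (ht₂ : t₂ ≤ 2 * T) (n : ℕ) (c : ℂ) :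
    c * ∑ q ∈ (Ioc T t₂).filter (fun q : ℕ => q % 4 = 1),
        g q * ((jacobiSym (n : ℤ) q : ℂ) * rootWeylSum h (n * q)) =
      ∑ q ∈ (Ioc T (2 * T)).filter (fun q : ℕ => q % 4 = 1 ∧ Nat.Coprime n q),
        c * (if q ∈ (Ioc T t₂).filter (fun q : ℕ => q % 4 = 1) then g q else 0) *
          (jacobiSym (n : ℤ) q : ℂ) * rootWeylSum h (n * q) := by
  set S₂ := (Ioc T t₂).filter (fun q : ℕ => q % 4 = 1) with hS₂
  have hsub : S₂ ⊆ (Ioc T (2 * T)).filter (fun q : ℕ => q % 4 = 1) := by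
    intro q hq
    rw [hS₂, Finset.mem_filter, Finset.mem_Ioc] at hq
    rw [Finset.mem_filter, Finset.mem_Ioc]
    exact ⟨⟨hq.1.1, hq.1.2.trans ht₂⟩, hq.2⟩
  rw [Finset.mul_sum]
  have hL : ∑ q ∈ S₂, c * (g q * ((jacobiSym (n : ℤ) q : ℂ) * rootWeylSum h (n * q))) =
      ∑ q ∈ (Ioc T (2 * T)).filter (fun q : ℕ => q % 4 = 1),
        if q ∈ S₂ then c * (g q * ((jacobiSym (n : ℤ) q : ℂ) * rootWeylSum h (n * q))) else 0 := by
    rw [← Finset.sum_filter, Finset.filter_mem_eq_inter, Finset.inter_eq_right.mpr hsub]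
  have hR : ∑ q ∈ (Ioc T (2 * T)).filter (fun q : ℕ => q % 4 = 1 ∧ Nat.Coprime n q),
      c * (if q ∈ S₂ then g q else 0) * (jacobiSym (n : ℤ) q : ℂ) * rootWeylSum h (n * q) =
      ∑ q ∈ (Ioc T (2 * T)).filter (fun q : ℕ => q % 4 = 1),
        if Nat.Coprime n q then
          c * (if q ∈ S₂ then g q else 0) * (jacobiSym (n : ℤ) q : ℂ) * rootWeylSum h (n * q)
        else 0 := by
    rw [← Finset.sum_filter, Finset.filter_filter]
  rw [hL, hR]
  refine Finset.sum_congr rfl fun q hq => ?_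
  have hq0 : q ≠ 0 := by
    have := (Finset.mem_Ioc.mp (Finset.mem_filter.mp hq).1).1; omega
  by_cases hc : Nat.Coprime n q
  · rw [if_pos hc]
    split_ifs <;> ring
  · rw [if_neg hc, jacobiSym_natCast_eq_zero_of_not_coprime hq0 hc]
    split_ifs <;> simp

/-- **The block hypothesis `H` from the K2′ bound.** If the K2′ body at `(M, R, T)` has norm `≤ Y₀`
for all unit coefficients, `‖g(q)‖ ≤ L_g` on `S₂ = (T,t₂] ∩ {q ≡ 1}` (`t₂ ≤ 2T`, `L_g > 0`) and
`0 ≤ L_c`, then for all unit `α, γ`: `‖Σ_{m,r} α(m)γ(r)·(L_c G(mr))‖ ≤ L_c L_g Y₀`,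
`G(n) = Σ_{q ∈ S₂} g(q)(n|q)S(h,nq)`. [folklore] -/
theorem typeII_H_of_K2 (h : ℤ) (g : ℕ → ℂ) (M R T t₂ : ℕ) (ht₂ : t₂ ≤ 2 * T) {Lg Lc Y₀ : ℝ}
    (hLg : 0 < Lg) (hLc : 0 ≤ Lc)
    (hg : ∀ q ∈ (Ioc T t₂).filter (fun q : ℕ => q % 4 = 1), ‖g q‖ ≤ Lg)
    (hK2 : ∀ α γ β : ℕ → ℂ, (∀ m, ‖α m‖ ≤ 1) → (∀ r, ‖γ r‖ ≤ 1) → (∀ q, ‖β q‖ ≤ 1) →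
      ‖∑ m ∈ Ioc M (2 * M), ∑ r ∈ Ioc R (2 * R),
          ∑ q ∈ (Ioc T (2 * T)).filter (fun q : ℕ => q % 4 = 1 ∧ Nat.Coprime (m * r) q),
            α m * γ r * β q * (jacobiSym ((m * r : ℕ) : ℤ) q : ℂ) * rootWeylSum h (m * r * q)‖ ≤ Y₀) :
    ∀ α γ : ℕ → ℂ, (∀ m, ‖α m‖ ≤ 1) → (∀ r, ‖γ r‖ ≤ 1) →
      ‖∑ m ∈ Ioc M (2 * M), ∑ r ∈ Ioc R (2 * R), α m * γ r *
          ((Lc : ℂ) * ∑ q ∈ (Ioc T t₂).filter (fun q : ℕ => q % 4 = 1),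
            g q * ((jacobiSym ((m * r : ℕ) : ℤ) q : ℂ) * rootWeylSum h (m * r * q)))‖ ≤
        Lc * Lg * Y₀ := by
  intro α γ hα hγ
  set S₂ := (Ioc T t₂).filter (fun q : ℕ => q % 4 = 1) with hS₂
  set β : ℕ → ℂ := fun q => (if q ∈ S₂ then g q else 0) / (Lg : ℂ) with hβ
  have hLgC : (Lg : ℂ) ≠ 0 := by exact_mod_cast hLg.ne'
  have hβ1 : ∀ q, ‖β q‖ ≤ 1 := by
    intro q
    simp only [hβ]
    rw [norm_div, Complex.norm_real, Real.norm_eq_abs, abs_of_pos hLg, div_le_one hLg]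
    split_ifs with hq
    · exact hg q hq
    · rw [norm_zero]; exact hLg.le
  have hβg : ∀ q, (if q ∈ S₂ then g q else 0) = (Lg : ℂ) * β q := fun q => by
    simp only [hβ]; field_simp
  -- pointwise in `(m, r)`
  have hpt : ∀ m r : ℕ, α m * γ r *
      ((Lc : ℂ) * ∑ q ∈ S₂, g q * ((jacobiSym ((m * r : ℕ) : ℤ) q : ℂ) * rootWeylSum h (m * r * q))) =
      (Lc : ℂ) * ((Lg : ℂ) *
        ∑ q ∈ (Ioc T (2 * T)).filter (fun q : ℕ => q % 4 = 1 ∧ Nat.Coprime (m * r) q),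
          α m * γ r * β q * (jacobiSym ((m * r : ℕ) : ℤ) q : ℂ) * rootWeylSum h (m * r * q)) := by
    intro m r
    have hs := slice_pointwise h g T t₂ ht₂ (m * r) (α m * γ r)
    rw [show α m * γ r * ((Lc : ℂ) * ∑ q ∈ S₂, g q *
        ((jacobiSym ((m * r : ℕ) : ℤ) q : ℂ) * rootWeylSum h (m * r * q))) =
        (Lc : ℂ) * (α m * γ r * ∑ q ∈ S₂, g q *
          ((jacobiSym ((m * r : ℕ) : ℤ) q : ℂ) * rootWeylSum h (m * r * q))) by ring, hs]
    congr 1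
    rw [Finset.mul_sum]
    refine Finset.sum_congr rfl fun q _ => ?_
    rw [hβg q]
    ring
  have hsum : ∑ m ∈ Ioc M (2 * M), ∑ r ∈ Ioc R (2 * R), α m * γ r *
        ((Lc : ℂ) * ∑ q ∈ S₂, g q * ((jacobiSym ((m * r : ℕ) : ℤ) q : ℂ) * rootWeylSum h (m * r * q))) =
      (Lc : ℂ) * ((Lg : ℂ) * ∑ m ∈ Ioc M (2 * M), ∑ r ∈ Ioc R (2 * R),
        ∑ q ∈ (Ioc T (2 * T)).filter (fun q : ℕ => q % 4 = 1 ∧ Nat.Coprime (m * r) q),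
          α m * γ r * β q * (jacobiSym ((m * r : ℕ) : ℤ) q : ℂ) * rootWeylSum h (m * r * q)) := by
    simp_rw [hpt]
    rw [Finset.mul_sum, Finset.mul_sum]
    refine Finset.sum_congr rfl fun m _ => ?_
    rw [Finset.mul_sum, Finset.mul_sum]
  rw [hsum, norm_mul, norm_mul, Complex.norm_real, Complex.norm_real, Real.norm_eq_abs,
    Real.norm_eq_abs, abs_of_nonneg hLc, abs_of_pos hLg, ← mul_assoc]
  exact mul_le_mul_of_nonneg_left (hK2 α γ β hα hγ hβ1) (mul_nonneg hLc hLg.le)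

/-- **The window majorant of a Type II piece**: with `τ ≤ D` on the relevant ranges and `‖g‖ ≤ L_g`
on `S₂`, `τ(n)·‖L_c G(n)‖ ≤ L_c L_g D³ #S₂` for `G(n) = Σ_{q ∈ S₂} g(q)(n|q)S(h,nq)`. [folklore] -/
theorem typeII_Phi (h : ℤ) (g : ℕ → ℂ) (T t₂ : ℕ) {Lg Lc D : ℝ} (hLg : 0 ≤ Lg) (hLc : 0 ≤ Lc)
    (hD : 0 ≤ D) (hg : ∀ q ∈ (Ioc T t₂).filter (fun q : ℕ => q % 4 = 1), ‖g q‖ ≤ Lg)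
    (hDq : ∀ q ∈ (Ioc T t₂).filter (fun q : ℕ => q % 4 = 1), (q.divisors.card : ℝ) ≤ D)
    (n : ℕ) (hDn : (n.divisors.card : ℝ) ≤ D) :
    (n.divisors.card : ℝ) * ‖(Lc : ℂ) * ∑ q ∈ (Ioc T t₂).filter (fun q : ℕ => q % 4 = 1),
        g q * ((jacobiSym (n : ℤ) q : ℂ) * rootWeylSum h (n * q))‖ ≤
      Lc * Lg * D ^ 3 * ((Ioc T t₂).filter (fun q : ℕ => q % 4 = 1)).card := by
  set S₂ := (Ioc T t₂).filter (fun q : ℕ => q % 4 = 1) with hS₂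
  have hG : ‖∑ q ∈ S₂, g q * ((jacobiSym (n : ℤ) q : ℂ) * rootWeylSum h (n * q))‖ ≤
      S₂.card * (Lg * (D * D)) := by
    calc _ ≤ ∑ q ∈ S₂, ‖g q * ((jacobiSym (n : ℤ) q : ℂ) * rootWeylSum h (n * q))‖ := norm_sum_le _ _
      _ ≤ ∑ q ∈ S₂, Lg * (D * D) := by
          refine Finset.sum_le_sum fun q hq => ?_
          rw [norm_mul]
          exact mul_le_mul (hg q hq) ((norm_kernel_le h n q).trans (mul_le_mul hDn (hDq q hq)
            (Nat.cast_nonneg _) hD)) (norm_nonneg _) hLg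
      _ = S₂.card * (Lg * (D * D)) := by rw [Finset.sum_const, nsmul_eq_mul]
  rw [norm_mul, Complex.norm_real, Real.norm_eq_abs, abs_of_nonneg hLc]
  have hτ0 : (0 : ℝ) ≤ n.divisors.card := Nat.cast_nonneg _
  calc (n.divisors.card : ℝ) * (Lc * ‖∑ q ∈ S₂, g q * ((jacobiSym (n : ℤ) q : ℂ) * rootWeylSum h (n * q))‖)
      ≤ D * (Lc * (S₂.card * (Lg * (D * D)))) :=
        mul_le_mul hDn (mul_le_mul_of_nonneg_left hG hLc) (by positivity) hD
    _ = Lc * Lg * D ^ 3 * S₂.card := by ring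

end Summit.Parity.BatemanHorn.Cruxes.SplitBlockJacobiCorner.Sketch.MbbOfBoxInputs

namespace Summit.Parity.BatemanHorn.Cruxes.SplitBlockJacobiCorner.Sketch

open Summit.Parity.BatemanHorn.Cruxes.SplitBlockJacobi.CofactorRootDiscrepancy

/-- **Registered stub form** (symmetry of the K2′ body under `(α,M) ↔ (γ,R)`): restated in `∀`-form in the crux-line namespace under
the name registered on stmt-Parity-15002. [folklore] -/
theorem mbbBoundsII_body_swap :
    ∀ (k : ℤ) (α γ β : ℕ → ℂ) (M R T : ℕ), ∑ m ∈ Finset.Ioc M (2 * M), ∑ r ∈ Finset.Ioc R (2 * R), ∑ q ∈ (Finset.Ioc T (2 * T)).filter (fun q : ℕ => q % 4 = 1 ∧ Nat.Coprime (m * r) q), α m * γ r * β q * (jacobiSym ((m * r : ℕ) : ℤ) q : ℂ) * rootWeylSum k (m * r * q) = ∑ m ∈ Finset.Ioc R (2 * R), ∑ r ∈ Finset.Ioc M (2 * M), ∑ q ∈ (Finset.Ioc T (2 * T)).filter (fun q : ℕ => q % 4 = 1 ∧ Nat.Coprime (m * r) q), γ m * α r * β q * (jacobiSym ((m * r : ℕ)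 : ℤ) q : ℂ) * rootWeylSum k (m * r * q) :=
  fun k α γ β M R T => MbbOfBoxInputs.trilinear_body_swap k α γ β M R T

end Summit.Parity.BatemanHorn.Cruxes.SplitBlockJacobiCorner.Sketch

end
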